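import Literature.MathematicalPhysics.KineticTheory.HardSphereEulerContinuousDependence
import Literature.MathematicalPhysics.KineticTheory.HardSphereEulerLocalTheory
import Literature.MathematicalPhysics.KineticTheory.HardSphereEulerSolutionGluing
import HarnessLib

/-!
# Continuous dependence at the ideal-gas limit (`hsEuler_continuousDependence`): reduction to the
# local theory and a fixed-horizon a-priori stability estimate

MathematicalPhysics/KineticTheory, proofs file of `HardSphereEulerContinuousDependence.lean` (the
named fact `hsEuler_continuousDependence`, Kato 1975 Thm III rendered for the hard-sphere Euler
family `p_σ = ρθZ(ρσ³)` on `𝕋³` at `σ = 0`). Kato's proof of Thm III (ARMA 58 (1975); energy-method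
version Majda 1984 Ch. 2, Thms 2.1–2.2; Dafermos 2005 Ch. V, Thms 5.1.1, 5.2.1) has four layers:

1. EXISTENCE of the perturbed solution for short time (Thms I–II) — in the tree the named fact
   `hsEuler_localExistence` (`HardSphereEulerLocalTheory.lean`, part (a));
2. CONTINUATION while the `C¹` norm stays bounded and the state stays in a compact region (Majda
   Thm 2.2) — the named fact `hsEuler_continuation` (part (b));
3. UNIQUENESS of classical solutions (Dafermos Thm 5.2.1; needed to glue the local solutions of
   layer 1 into one solution on the prescribed horizon);
4. the A-PRIORI STABILITY ESTIMATE on a fixed horizon `[0, T']`, `T' < T₁` (the energy inequality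
   for the difference with the smooth reference, Grönwall, and a continuity argument): every
   classical `σ`-solution on `[0, T)`, `T ≤ T'`, whose data are `δ`-close in `Cᵏ` to the reference
   data, obeys uniform state and `C¹` bounds and stays `ε`-close to the reference.

This file proves the ASSEMBLY of the four layers into `hsEuler_continuousDependence`
(`hsEuler_continuousDependence_of_localTheory`), with layers 1–2 taken as the named facts they are
in the tree and layers 3–4 as explicit hypotheses stated in the tree's vocabulary (they are
theorems of the energy method, to be proved in this file's sequels; layer 3 is proved on the summit
side as `Summit.AtomisticToContinuum.HydrodynamicLimit.Theorems.hsEuler_unique_of_analytic_eos`,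
not importable here). The soft continuation argument is
`IsHardSphereEulerSolution.exists_of_apriori` (`HardSphereEulerSolutionGluing.lean`). Nothing is
asserted: no new named fact is introduced, and `hsEuler_continuousDependence_holds` is NOT here
(it needs layers 1–4 discharged).

## The assembly (proof of `hsEuler_continuousDependence_of_localTheory`)

Given the equation-of-state data `(η₀, F)`, the ideal reference `(ρ₁, u₁, θ₁)` on `[0, T₁)`,
`0 < T₂ < T₁` and `ε > 0`: work on the horizon `T' := (T₂ + T₁)/2`; let `ηₐ, η_b, ηᵤ` be the
packing thresholds of layers 1, 2, 3 and `η := min`; let `(k, δ, M)` be given by layer 4 for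
`(T', ε)`, and `R := max ρ₁(0, ·)`. For `σ < δ' := min {δ, 1, η/(R + 1 + M)}` and data `δ'`-close
in `Cᵏ`: the data have packing `ρ₀σ³ ≤ (R + 1)σ ≤ η ≤ ηₐ`, so layer 1 launches a solution; by
layer 4 every solution with the data on `[0, T)`, `T ≤ T'`, has `ρ ≤ M`, hence packing
`≤ Mσ ≤ η ≤ min η_b ηᵤ`, so layer 3 makes such solutions unique and layer 2 continues them; the
gluing lemma yields a solution on `[0, T')`, `T' > T₂`, and layer 4 once more gives its
`ε`-closeness on `[0, T') × 𝕋³`.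

## References

* T. Kato, *The Cauchy problem for quasi-linear symmetric hyperbolic systems*, Arch. Rational Mech.
  Anal. 58 (1975) 181–205: Thms I–III. [`Kato1975`]
* A. Majda, *Compressible Fluid Flow and Systems of Conservation Laws in Several Space Variables*
  (1984), Ch. 2, §2.1, Thms 2.1–2.2. [`Majda1984`]
* C. M. Dafermos, *Hyperbolic Conservation Laws in Continuum Physics*, 2nd ed. (2005), Ch. V,
  Thm 5.1.1 (existence, maximal interval), Thm 5.2.1 (stability/uniqueness of classical
  solutions). [`Dafermos2005`]
-/

noncomputable section

open Set

namespace Literature.MathematicalPhysics.KineticTheory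

open Literature.Analysis.FunctionSpaces

/-- `Cᵏ`-closeness of the periodic lifts at order `0` is sup-norm closeness on the torus
(`‖D⁰g‖ = ‖g‖`, `Torus.proj` is onto). [folklore] -/
theorem abs_le_of_norm_iteratedFDeriv_lift_le {g : T3 → ℝ} {δ : ℝ} {k : ℕ}
    (h : ∀ n : ℕ, n ≤ k → ∀ y : EuclideanSpace ℝ (Fin 3),
      ‖iteratedFDeriv ℝ n (Torus.lift g) y‖ ≤ δ) (x : T3) : |g x| ≤ δ := by
  obtain ⟨y, rfl⟩ := Torus.proj_surjective x
  have h0 := h 0 (Nat.zero_le k) y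
  rwa [norm_iteratedFDeriv_zero, Torus.lift_apply, Real.norm_eq_abs] at h0

/-- A continuous real function on `𝕋³` is bounded above (compactness). [folklore] -/
theorem exists_forall_le_of_continuous_T3 {f : T3 → ℝ} (hf : Continuous f) : ∃ R : ℝ, ∀ x, f x ≤ R := by
  obtain ⟨x₀, -, hx₀⟩ := isCompact_univ.exists_isMaxOn univ_nonempty hf.continuousOn
  exact ⟨f x₀, fun x => isMaxOn_iff.1 hx₀ x (mem_univ x)⟩

/-- **Kato's Thm III for the hard-sphere Euler family at `σ = 0`, assembled from its four layers.**
IF (1) `hsEuler_localExistence` and (2) `hsEuler_continuation` hold (named facts of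
`HardSphereEulerLocalTheory.lean`: Kato 1975 Thms I–II / Majda 1984 Thms 2.1–2.2 / Dafermos 2005
Thm 5.1.1 for this system), (3) classical solutions at small packing are unique (Dafermos 2005
Thm 5.2.1: under the equation-of-state hypothesis there is `η₁ > 0` such that for every `σ > 0` two
classical solutions on `[0, T) × 𝕋³` with packing `≤ η₁` and equal data coincide), and (4) the
fixed-horizon a-priori stability estimate holds (for every ideal-gas reference solution on
`[0, T₁)`, every `0 < T' < T₁` and `ε > 0` there are `k`, `δ > 0`, `M > 0` such that for
`0 < σ < δ` and smooth positive data `δ`-close in `Cᵏ` to the reference data, EVERY classical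
`σ`-solution with these data on `[0, T)`, `T ≤ T'`, obeys `M⁻¹ ≤ ρ, θ ≤ M`, `‖u‖ ≤ M`,
`|∂ᵢ(ρ, u, θ)| ≤ M` and is `ε`-close to the reference pointwise on `[0, T) × 𝕋³` — the energy
inequality for the difference + Grönwall + continuity, Kato 1975 §§3–4 / Majda 1984 proof of
Thm 2.2), THEN `hsEuler_continuousDependence`. See the module docstring for the assembly.
[cite: Kato1975, Thm III] -/
theorem hsEuler_continuousDependence_of_localTheory
    (hloc : hsEuler_localExistence) (hcont : hsEuler_continuation)
    (huniq : ∀ η₀ : ℝ, 0 < η₀ → ∀ F : ℝ → ℝ, AnalyticOnNhd ℝ F (Ioo (-η₀) η₀) →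
      EqOn hsExcessFreeEnergy F (Ico 0 η₀) →
      ∃ η₁ : ℝ, 0 < η₁ ∧ ∀ σ : ℝ, 0 < σ →
        ∀ (T : ℝ) (ρ θ : ℝ → T3 → ℝ) (u : ℝ → T3 → V3) (ρ' θ' : ℝ → T3 → ℝ) (u' : ℝ → T3 → V3),
          IsHardSphereEulerSolution σ T ρ u θ → IsHardSphereEulerSolution σ T ρ' u' θ' →
          (∀ t ∈ Ico 0 T, ∀ x, ρ t x * σ ^ 3 ≤ η₁) → (∀ t ∈ Ico 0 T, ∀ x, ρ' t x * σ ^ 3 ≤ η₁) →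
          ρ 0 = ρ' 0 → u 0 = u' 0 → θ 0 = θ' 0 →
          ∀ t ∈ Ico 0 T, ρ t = ρ' t ∧ u t = u' t ∧ θ t = θ' t)
    (hstab : ∀ η₀ : ℝ, 0 < η₀ → ∀ F : ℝ → ℝ, AnalyticOnNhd ℝ F (Ioo (-η₀) η₀) →
      EqOn hsExcessFreeEnergy F (Ico 0 η₀) →
      ∀ (T₁ : ℝ) (ρ₁ θ₁ : ℝ → T3 → ℝ) (u₁ : ℝ → T3 → V3), IsHardSphereEulerSolution 0 T₁ ρ₁ u₁ θ₁ →
        ∀ T' : ℝ, 0 < T' → T' < T₁ → ∀ ε : ℝ, 0 < ε →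
        ∃ k : ℕ, ∃ δ M : ℝ, 0 < δ ∧ 0 < M ∧ ∀ σ : ℝ, 0 < σ → σ < δ →
          ∀ (ρ₀ θ₀ : T3 → ℝ) (u₀ : T3 → V3),
            Torus.IsSmooth ρ₀ → Torus.IsSmooth θ₀ → Torus.IsSmooth u₀ →
            (∀ x, 0 < ρ₀ x) → (∀ x, 0 < θ₀ x) →
            (∀ n : ℕ, n ≤ k → ∀ y : EuclideanSpace ℝ (Fin 3),
              ‖iteratedFDeriv ℝ n (Torus.lift fun x => ρ₀ x - ρ₁ 0 x) y‖ ≤ δ) →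
            (∀ n : ℕ, n ≤ k → ∀ y : EuclideanSpace ℝ (Fin 3),
              ‖iteratedFDeriv ℝ n (Torus.lift fun x => θ₀ x - θ₁ 0 x) y‖ ≤ δ) →
            (∀ n : ℕ, n ≤ k → ∀ y : EuclideanSpace ℝ (Fin 3),
              ‖iteratedFDeriv ℝ n (Torus.lift fun x => u₀ x - u₁ 0 x) y‖ ≤ δ) →
            ∀ T : ℝ, T ≤ T' → ∀ (ρ θ : ℝ → T3 → ℝ) (u : ℝ → T3 → V3),
              IsHardSphereEulerSolution σ T ρ u θ → ρ 0 = ρ₀ → u 0 = u₀ → θ 0 = θ₀ →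
              ∀ t ∈ Ico 0 T, ∀ x,
                (M⁻¹ ≤ ρ t x ∧ ρ t x ≤ M ∧ M⁻¹ ≤ θ t x ∧ θ t x ≤ M ∧ ‖u t x‖ ≤ M ∧
                  ∀ i : Fin 3, ‖Torus.partialDeriv i (u t) x‖ ≤ M ∧
                    |Torus.partialDeriv i (ρ t) x| ≤ M ∧ |Torus.partialDeriv i (θ t) x| ≤ M) ∧
                (|ρ t x - ρ₁ t x| < ε ∧ ‖u t x - u₁ t x‖ < ε ∧ |θ t x - θ₁ t x| < ε)) :
    hsEuler_continuousDependence := by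
  intro η₀ hη₀ F hF hEq T₁ ρ₁ θ₁ u₁ hE₁ T₂ hT₂ hT₂₁ ε hε
  obtain ⟨ηa, hηa, Hloc⟩ := hloc η₀ hη₀ F hF hEq
  obtain ⟨ηb, hηb, Hcont⟩ := hcont η₀ hη₀ F hF hEq
  obtain ⟨ηu, hηu, Huniq⟩ := huniq η₀ hη₀ F hF hEq
  -- the working horizon `T' ∈ (T₂, T₁)`
  obtain ⟨T', hT'pos, hT'lt, hT₂T'⟩ : ∃ T' : ℝ, 0 < T' ∧ T' < T₁ ∧ T₂ < T' :=
    ⟨(T₂ + T₁) / 2, by linarith, by linarith, by linarith⟩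
  obtain ⟨k, δ, M, hδ, hM, Hstab⟩ :=
    hstab η₀ hη₀ F hF hEq T₁ ρ₁ θ₁ u₁ hE₁ T' hT'pos hT'lt ε hε
  -- a bound on the reference density datum
  have h0 : (0 : ℝ) ∈ Ico 0 T₁ := ⟨le_rfl, hT₂.trans hT₂₁⟩
  obtain ⟨R₀, hR₀⟩ := exists_forall_le_of_continuous_T3
    (hE₁.smooth_density.isSmooth_slice h0).continuous
  obtain ⟨R, hRpos, hR⟩ : ∃ R : ℝ, 0 < R ∧ ∀ x, ρ₁ 0 x ≤ R :=
    ⟨max R₀ 1, lt_max_of_lt_right one_pos, fun x => (hR₀ x).trans (le_max_left _ _)⟩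
  -- one packing threshold below those of the three layers
  obtain ⟨η, hηpos, hηa', hηb', hηu'⟩ : ∃ η : ℝ, 0 < η ∧ η ≤ ηa ∧ η ≤ ηb ∧ η ≤ ηu :=
    ⟨min ηa (min ηb ηu), lt_min hηa (lt_min hηb hηu), min_le_left _ _,
      (min_le_right _ _).trans (min_le_left _ _), (min_le_right _ _).trans (min_le_right _ _)⟩
  -- the final smallness `δ'`
  have hc : 0 < R + 1 + M := by linarith
  obtain ⟨δ', hδ'pos, hδ'δ, hδ'1, hδ'c⟩ :
      ∃ δ' : ℝ, 0 < δ' ∧ δ' ≤ δ ∧ δ' ≤ 1 ∧ δ' ≤ η / (R + 1 + M) :=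
    ⟨min δ (min 1 (η / (R + 1 + M))), lt_min hδ (lt_min one_pos (div_pos hηpos hc)),
      min_le_left _ _, (min_le_right _ _).trans (min_le_left _ _),
      (min_le_right _ _).trans (min_le_right _ _)⟩
  have hδ'R : δ' * (R + 1) ≤ η := by
    have h1 : δ' * (R + 1) ≤ η / (R + 1 + M) * (R + 1 + M) :=
      mul_le_mul hδ'c (by linarith) (by linarith) (div_pos hηpos hc).le
    rwa [div_mul_cancel₀ _ hc.ne'] at h1
  have hδ'M : δ' * M ≤ η := by
    have h1 : δ' * M ≤ η / (R + 1 + M) * (R + 1 + M) :=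
      mul_le_mul hδ'c (by linarith) hM.le (div_pos hηpos hc).le
    rwa [div_mul_cancel₀ _ hc.ne'] at h1
  refine ⟨k, δ', hδ'pos, ?_⟩
  intro σ hσ hσδ' ρ₀ θ₀ u₀ hρ₀s hθ₀s hu₀s hρ₀p hθ₀p hdρ hdθ hdu
  have hσδ : σ < δ := hσδ'.trans_le hδ'δ
  have hσ3 : σ ^ 3 ≤ σ := pow_le_of_le_one hσ.le (hσδ'.le.trans hδ'1) (by norm_num)
  have hσ3nn : 0 ≤ σ ^ 3 := pow_nonneg hσ.le 3
  -- layer 4 for these data (closeness `≤ δ' ≤ δ`)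
  have HS := Hstab σ hσ hσδ ρ₀ θ₀ u₀ hρ₀s hθ₀s hu₀s hρ₀p hθ₀p
    (fun n hn y => (hdρ n hn y).trans hδ'δ) (fun n hn y => (hdθ n hn y).trans hδ'δ)
    (fun n hn y => (hdu n hn y).trans hδ'δ)
  -- packing of the data: `ρ₀σ³ ≤ (R + 1)σ ≤ η ≤ ηₐ`
  have hpk0 : ∀ x, ρ₀ x * σ ^ 3 ≤ ηa := by
    intro x
    have hx : ρ₀ x ≤ R + 1 := by
      have h := (abs_le.1 (abs_le_of_norm_iteratedFDeriv_lift_le hdρ x)).2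
      have h' : ρ₀ x - ρ₁ 0 x ≤ δ' := h
      linarith [hR x]
    calc ρ₀ x * σ ^ 3 ≤ (R + 1) * σ := mul_le_mul hx hσ3 hσ3nn (by linarith)
      _ ≤ (R + 1) * δ' := mul_le_mul_of_nonneg_left hσδ'.le (by linarith)
      _ ≤ ηa := by linarith [mul_comm (R + 1) δ']
  -- packing of solutions with `ρ ≤ M`: `ρσ³ ≤ Mσ ≤ η`
  have hpkM : ∀ r : ℝ, r ≤ M → r * σ ^ 3 ≤ η := by
    intro r hr
    calc r * σ ^ 3 ≤ M * σ := mul_le_mul hr hσ3 hσ3nn hM.le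
      _ ≤ M * δ' := mul_le_mul_of_nonneg_left hσδ'.le hM.le
      _ ≤ η := by linarith [mul_comm M δ']
  -- layer 1: a local solution with the data
  have hlocal := Hloc σ hσ ρ₀ θ₀ u₀ hρ₀s hθ₀s hu₀s hρ₀p hθ₀p hpk0
  -- the gluing lemma, with the a-priori property := the bounds of layer 2 with `(M, η_b)`;
  -- (ii) uniqueness among solutions with the data is layer 3 (packing from layer 4),
  -- (iii) continuation is layer 2, (iv) the bounds are a-priori by layer 4
  obtain ⟨ρ, θ, u, hsol, hρ0, hu0, hθ0⟩ := IsHardSphereEulerSolution.exists_of_apriori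
    (fun T ρ u θ => ∀ t ∈ Ico 0 T, ∀ x,
      M⁻¹ ≤ ρ t x ∧ ρ t x ≤ M ∧ M⁻¹ ≤ θ t x ∧ θ t x ≤ M ∧ ‖u t x‖ ≤ M ∧
      ρ t x * σ ^ 3 ≤ ηb ∧
      ∀ i : Fin 3, ‖Torus.partialDeriv i (u t) x‖ ≤ M ∧
        |Torus.partialDeriv i (ρ t) x| ≤ M ∧ |Torus.partialDeriv i (θ t) x| ≤ M)
    hT'pos hlocal
    (fun T hT ρa θa ua ρb θb ub ha hb hρa hua hθa hρb hub hθb => by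
      have hpa : ∀ t ∈ Ico 0 T, ∀ x, ρa t x * σ ^ 3 ≤ ηu := fun t ht x =>
        (hpkM _ (HS T hT ρa θa ua ha hρa hua hθa t ht x).1.2.1).trans hηu'
      have hpb : ∀ t ∈ Ico 0 T, ∀ x, ρb t x * σ ^ 3 ≤ ηu := fun t ht x =>
        (hpkM _ (HS T hT ρb θb ub hb hρb hub hθb t ht x).1.2.1).trans hηu'
      exact Huniq σ hσ T ρa θa ua ρb θb ub ha hb hpa hpb (hρa.trans hρb.symm)
        (hua.trans hub.symm) (hθa.trans hθb.symm))
    (fun T hT _ ρ θ u hsol _ _ _ hP => Hcont σ hσ T M hT hM ρ θ u hsol hP)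
    (fun T hT ρ θ u hsol hρ0 hu0 hθ0 t ht x => by
      have hb := (HS T hT ρ θ u hsol hρ0 hu0 hθ0 t ht x).1
      exact ⟨hb.1, hb.2.1, hb.2.2.1, hb.2.2.2.1, hb.2.2.2.2.1, (hpkM _ hb.2.1).trans hηb',
        hb.2.2.2.2.2⟩)
  -- conclusion: the solution on `[0, T')`, `T' > T₂`, is `ε`-close by layer 4
  exact ⟨T', hT₂T', ρ, θ, u, hsol, hρ0, hu0, hθ0,
    fun t ht x => (HS T' le_rfl ρ θ u hsol hρ0 hu0 hθ0 t ht x).2⟩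

end Literature.MathematicalPhysics.KineticTheory

end
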